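import Summits.QuantumFields.BalabanUV.Beta.FP.PeriodisedSymBorderT2IndexWard
import Summits.QuantumFields.BalabanUV.Beta.CombWilsonT2PeriodisedK2

/-!
# `BalabanUV.Beta.FP.PeriodisedSymBorderT2IndexWardSnd` — road «FP» for binder row D1, ROUTE T, (J-a) (α) AT ORDER 2 ON THE BORDER, sequel:
# **PAIR SYMMETRY OF THE TORUS SECOND-ORDER BORDER MEMBER, THE SECOND-SLOT LAW, AND THE BI-WEIGHTED FORMS** — the border twin of an2 g42's
# `CombWilsonT2PeriodisedK2` §1–§2 over `PeriodisedSymBorderT2IndexWard` (this seat's B1)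

WHAT (`d = 3`; bi-family hypothesis-bound with the SECOND bond first, `hW : W = fun κ′ u′ κ u x z a c => Σ'_n symVh₂SAn1 3 Lc κ u κ′ (translate M u′ n) x z a c`;
torus member on the `Q`-slot block `Q₁₂^{b,b′} := (perF F (dper F (W b′.2 ↑b′.1 b.2 ↑b.1))).submatrix (coarsePt∘inr) (inl)`):
* §1 `dper_borderT2per_apply` (the member's kernel is the DOUBLE copy sum `Σ'_m Σ'_n symVh₂SAn1 κ (u+M∘m) κ′ (u′+M∘n)`), the `(inl, inr)` windows by the anti-twin,
  finite-rectangle Fubini on the two border blocks, and **`dper_borderT2per_swap`** (PAIR SYMMETRY `dper M (W κ′ u′ κ u) = dper M (W κ u κ′ u′)`, from an1's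
  `symVh₂SAn1_swap` copy by copy).
* §2 ANY box `M = Lc·M′`, ANY multiplier presentation (rows `(pμ a, inr (mμ a))` — (α-1)'s `_of_presentation` generality, so that the SAME letters serve the
  door's fine level (`M = fine Lc M′`, `pμ = coarsePt`) AND the coarse level one up (`M = M′`, `pμ = pμ′`; the OWNER d1-p3 g22's answer to Q-d1leaf02-g22-1
  binds `Q₂₂` over this bi-member on `M′`)): **`torus_symQ12_pureGauge_snd_fun_of_presentation`** (a torus pure gauge in the SECOND bond:
  `Σ_{b′} (Dλ)_{b′} • Q₂^{b,b′} = −(R_λ * Q₁^{b} − Q₁^{b} * E_λ)`), the bi-weighted forms **`torus_symQ12_gauge_fst_of_presentation`** ∕ **`_snd_of_presentation`**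
  (`Σ_b Σ_{b′} ((Dλ)_b·g b′) • Q₂^{b,b′} = −(R_λ * Q₁^{(g)} − Q₁^{(g)} * E_λ) = Σ_b Σ_{b′} (g b·(Dλ)_{b′}) • Q₂^{b,b′}`, `Q₁^{(g)} := Σ_b g b • Q₁^{b}`);
  §3 the (III′) corollaries **`torus_symQ12_pureGauge_snd_fun`**, **`torus_symQ12_gauge_fst`**, **`torus_symQ12_gauge_snd`**.
[folklore] re-indexing of finitely supported sums BY NAME; no `def`, no `def … : Prop`, nothing cited, 0 sorry.  Nothing of the dictionary ∕ Bałaban's asserted;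
the door's `q2 ∕ c2 ∕ d2` rows are NOT discharged here (B1's header: `Q₂₂`'s binding and the order-2 fluctuation-leg law are the road's ∕ the dictionary's).

HONEST DEPENDENCY (page 1, mandatory): continuum YM on T⁴ ⇐ BetaPertH ∧ nine spine estimates (0/9 proved); BetaPertH ⇐ (D1) ∧ (D4) ∧ CAP+tail;
G-an2-4 gates asym, D1 and NE2/3/4.  HONEST FRAMING (cell contract, verbatim): «discharging `BetaPertH` makes Bałaban's UV stability UNCONDITIONAL —
a real constructive-QFT result; it is NOT the continuum limit and NOT the Clay problem.»  ABSOLUTE RULE (cell charter, verbatim): «No internally-minted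
statement may enter as a cited fact. Every hypothesis is either kernel-proved in this package or a verbatim quotation of a PUBLISHED theorem with page
reference. The manuscript(s) under audit are NOT citable for their own disputed steps — they are the thing under adjudication; programme-internal
(2001/route/tribunal) claims are never citable.»  0 estimates; 0∕4 row-D1 binders; NOT (T-ID), NOT (J-a) complete, NOT SDF, NOT D1, NOT BetaPertH, NOT
continuum, NOT Clay.  D1 formalisation swarm LEAF PROVER 02 (b2b-balaban-beta-d1-formalise-leaf-02 gen 22), 2026-08-22.  No existing file touched.
-/

noncomputable section

open scoped BigOperators

namespace Summit.QuantumFields.BalabanUV.Beta.FP.PeriodisedSymBorderT2IndexWardSnd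

open Finset Matrix
open Literature.MathematicalPhysics.QuantumFieldTheory.Balaban1983to89
open Literature.MathematicalPhysics.QuantumFieldTheory.Balaban1983to89.Beta
open B4TorusKernel.MultiPeriod (translate translate_apply)
open ExpKernelCalculus (MKer)
open B5Prop11Plancherel (fine)
open B6Lemma24Torus (pbox mem_pbox)
open AffineAveraging (Site box toSite)
open AveragingContours (blk off)
open AveragingContoursRooted (ctr ctrOff ctrOff_mem_box)
open OneStepResolventKernel (Fib)
open Summit.QuantumFields.BalabanUV.Beta.SymAveragingHessianCounts (symVhSAt)
open Summit.QuantumFields.BalabanUV.Beta.SymSecondOrderTablesAn1 (symVh₂SAn1 symVh₂SAn1_inl_inl symVh₂SAn1_inr_inr symVh₂SAn1_antiTwin symVh₂SAn1_swap)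
open Summit.QuantumFields.BalabanUV.Beta.FP.KernelPeriodisationFib (Idx perF perF_apply perZ perZ_apply)
open Summit.QuantumFields.BalabanUV.Beta.FP.KernelPeriodisationFibLoc (dper dper_apply)
open Summit.QuantumFields.BalabanUV.Beta.FP.TorusGaugeCovariance (tdelta tgrad nearBox mem_nearBox)
open Summit.QuantumFields.BalabanUV.Beta.FP.TorusGaugeCovarianceCoarse (coarsePt coarsePt_coe)
open Summit.QuantumFields.BalabanUV.Beta.FP.PeriodisedBorderIndexWard (translate_injective)
open Summit.QuantumFields.BalabanUV.Beta.CombWilsonT2Periodised (dper_apply_of_periodCov)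
open Summit.QuantumFields.BalabanUV.Beta.CombWilsonT2PeriodisedK2 (tsum_tsum_comm_of_support)
open Summit.QuantumFields.BalabanUV.Beta.FP.PeriodisedSymBorderT2IndexWard (symVh₂SAn1_inr_inl_eq_zero_of_not_mem_fst symVh₂SAn1_inr_inl_eq_zero_of_not_mem_snd
  borderT2per_periodCov torus_symQ12_pureGauge_fst_fun_of_presentation)

variable {Lc : ℕ} [NeZero Lc]

/-! ## §1 The member's kernel as a double copy sum; pair symmetry -/

section Symmetry

variable {M M' : Fin 4 → ℕ} [∀ μ, NeZero (M μ)]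
  {W : Fin 4 → Site 4 → Fin 4 → Site 4 → MKer 4 (Fib 3)}

omit [NeZero Lc] in
/-- [folklore] the `(inl α, inr μ)` entry of the row border table is minus its `(inr μ, inl α)` entry at the swapped sites (`symVh₂SAn1_antiTwin`). -/
theorem symVh₂SAn1_inl_inr_eq_neg (κ : Fin 4) (u : Site 4) (κ' : Fin 4) (u' x z : Site 4) (α μ : Fin 4) :
    symVh₂SAn1 3 Lc κ u κ' u' x z (Sum.inl α) (Sum.inr μ) = -symVh₂SAn1 3 Lc κ u κ' u' z x (Sum.inr μ) (Sum.inl α) := by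
  rw [symVh₂SAn1_antiTwin, neg_neg]

omit [∀ μ, NeZero (M μ)] in
/-- [folklore] **THE MEMBER's KERNEL IS THE DOUBLE COPY SUM** (`M = Lc·M′`): `dper M (W κ′ u′ κ u) x z a c = Σ'_m Σ'_n symVh₂SAn1 3 Lc κ (u + M∘m) κ′ (u′ + M∘n) x z a c`
(an2's `dper_apply_of_periodCov` + B1's `borderT2per_periodCov`). -/
theorem dper_borderT2per_apply (hM : ∀ i, M i = Lc * M' i)
    (hW : W = fun κ' u' κ u x z a c => ∑' n : Site 4, symVh₂SAn1 3 Lc κ u κ' (translate M u' n) x z a c)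
    (κ' : Fin 4) (u' : Site 4) (κ : Fin 4) (u x z : Site 4) (a c : Fib 3) :
    dper M (W κ' u' κ u) x z a c = ∑' m : Site 4, ∑' n : Site 4, symVh₂SAn1 3 Lc κ (translate M u m) κ' (translate M u' n) x z a c := by
  have hV : W κ' u' = fun κ u x z a c => ∑' n : Site 4, symVh₂SAn1 3 Lc κ u κ' (translate M u' n) x z a c := by rw [hW]
  rw [dper_apply_of_periodCov (W κ' u') (borderT2per_periodCov κ' u' hM hV) κ u x z a c, hV]

/-- [folklore] the double copy sum commutes on the `(inr μ, inl α)` block (both copy indices range over the finite window `nearBox Lc (blk Lc x)` — B1's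
first- and second-bond windows). -/
theorem tsum_tsum_symVh₂SAn1_comm_inr_inl (κ : Fin 4) (u : Site 4) (κ' : Fin 4) (u' x z : Site 4) (μ α : Fin 4) :
    ∑' m : Site 4, ∑' n : Site 4, symVh₂SAn1 3 Lc κ (translate M u m) κ' (translate M u' n) x z (Sum.inr μ) (Sum.inl α)
      = ∑' n : Site 4, ∑' m : Site 4, symVh₂SAn1 3 Lc κ (translate M u m) κ' (translate M u' n) x z (Sum.inr μ) (Sum.inl α) :=
  tsum_tsum_comm_of_support (fun m n => symVh₂SAn1 3 Lc κ (translate M u m) κ' (translate M u' n) x z (Sum.inr μ) (Sum.inl α))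
    ((nearBox Lc (blk Lc x)).preimage (fun m => translate M u m) (translate_injective (M := M) u).injOn)
    ((nearBox Lc (blk Lc x)).preimage (fun n => translate M u' n) (translate_injective (M := M) u').injOn)
    (fun _ hm _ => symVh₂SAn1_inr_inl_eq_zero_of_not_mem_fst κ κ' _ x z μ α fun h => hm (Finset.mem_preimage.2 h))
    (fun _ hn _ => symVh₂SAn1_inr_inl_eq_zero_of_not_mem_snd κ _ κ' x z μ α fun h => hn (Finset.mem_preimage.2 h))

/-- [folklore] **PAIR SYMMETRY OF THE TORUS MEMBER's KERNEL**: `dper M (W κ′ u′ κ u) = dper M (W κ u κ′ u′)` — swap the table's bonds (an1's `symVh₂SAn1_swap`)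
and the two copy sums (finite-rectangle Fubini on the two border blocks; the diagonal blocks vanish). -/
theorem dper_borderT2per_swap (hM : ∀ i, M i = Lc * M' i)
    (hW : W = fun κ' u' κ u x z a c => ∑' n : Site 4, symVh₂SAn1 3 Lc κ u κ' (translate M u' n) x z a c)
    (κ' : Fin 4) (u' : Site 4) (κ : Fin 4) (u : Site 4) :
    dper M (W κ' u' κ u) = dper M (W κ u κ' u') := by
  funext x z a c
  rw [dper_borderT2per_apply hM hW, dper_borderT2per_apply hM hW]
  rcases a with α | μ <;> rcases c with γ | ν
  · simp only [symVh₂SAn1_inl_inl, tsum_zero]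
  · -- (inl α, inr ν): by the anti-twin, the `(inr ν, inl α)` block at the swapped sites
    simp only [symVh₂SAn1_inl_inr_eq_neg, tsum_neg]
    rw [tsum_tsum_symVh₂SAn1_comm_inr_inl (M := M) κ u κ' u' z x ν α]
    exact congrArg Neg.neg (tsum_congr fun n => tsum_congr fun m => by rw [symVh₂SAn1_swap])
  · rw [tsum_tsum_symVh₂SAn1_comm_inr_inl (M := M) κ u κ' u' x z μ γ]
    exact tsum_congr fun n => tsum_congr fun m => by rw [symVh₂SAn1_swap]
  · simp only [symVh₂SAn1_inr_inr, tsum_zero]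

end Symmetry

/-! ## §2 Any box, any multiplier presentation: the second-slot law and the bi-weighted forms; the (III′) corollary -/

section Presentation

variable {M M' : Fin 4 → ℕ} [∀ μ, NeZero (M μ)] {W : Fin 4 → Site 4 → Fin 4 → Site 4 → MKer 4 (Fib 3)}
  {κI : Type*} [Fintype κI] [DecidableEq κI]

/-- [folklore] **`torus_symQ12_pureGauge_snd_fun_of_presentation` — A TORUS PURE GAUGE IN THE SECOND BOND, ANY BOX `M = Lc·M′`, ANY MULTIPLIER PRESENTATION**
(rows `a ↦ (pμ a, inr (mμ a))`; pair symmetry + B1's first-slot law): for every torus bond `b` and torus gauge function `λ`,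
`Σ_{b′} (Dλ)_{b′} • Q₂^{b,b′} = −(R_λ * Q₁^{b} − Q₁^{b} * E_λ)`, `Q₂^{b,b′} := (perF M (dper M (W b′.2 ↑b′.1 b.2 ↑b.1))).submatrix …`,
`Q₁^{b} := (perF M (dper M (symVhSAt ρ_c 3 Lc rfl b.2 ↑b.1))).submatrix …`, `E_λ := diagonal (λ c.1)`, `R_λ := diagonal (Σ_s tdelta M (pμ a + ρ_c) s · λ s)`. -/
theorem torus_symQ12_pureGauge_snd_fun_of_presentation (hM : ∀ i, M i = Lc * M' i)
    (hW : W = fun κ' u' κ u x z a c => ∑' n : Site 4, symVh₂SAn1 3 Lc κ u κ' (translate M u' n) x z a c)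
    (pμ : κI → Site 4) (hpμ : ∀ a, pμ a ∈ pbox M) (mμ : κI → Fin 4) (b : ↥(pbox M) × Fin 4) (lam : ↥(pbox M) → ℝ) :
    (∑ b' : ↥(pbox M) × Fin 4, (∑ s : ↥(pbox M), tgrad M (b'.1, Sum.inl b'.2) s * lam s) •
        (perF M (dper M (W b'.2 (b'.1 : Site 4) b.2 (b.1 : Site 4)))).submatrix
          (fun a : κI => ((⟨pμ a, hpμ a⟩, Sum.inr (mμ a)) : Idx M (Fib 3)))
          (fun c : ↥(pbox M) × Fin 4 => ((c.1, Sum.inl c.2) : Idx M (Fib 3))))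
      = -(Matrix.diagonal (fun a : κI => ∑ s : ↥(pbox M), tdelta M (pμ a + ctr 4 Lc) s * lam s)
            * (perF M (dper M (symVhSAt (ctr 4 Lc) 3 Lc rfl b.2 (b.1 : Site 4)))).submatrix
              (fun a : κI => ((⟨pμ a, hpμ a⟩, Sum.inr (mμ a)) : Idx M (Fib 3)))
              (fun c : ↥(pbox M) × Fin 4 => ((c.1, Sum.inl c.2) : Idx M (Fib 3)))
          - (perF M (dper M (symVhSAt (ctr 4 Lc) 3 Lc rfl b.2 (b.1 : Site 4)))).submatrix
              (fun a : κI => ((⟨pμ a, hpμ a⟩, Sum.inr (mμ a)) : Idx M (Fib 3)))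
              (fun c : ↥(pbox M) × Fin 4 => ((c.1, Sum.inl c.2) : Idx M (Fib 3)))
            * Matrix.diagonal (fun c : ↥(pbox M) × Fin 4 => lam c.1)) := by
  rw [Finset.sum_congr rfl fun b' _ => by rw [dper_borderT2per_swap hM hW b'.2 (b'.1 : Site 4) b.2 (b.1 : Site 4)]]
  -- after the swap the member is B1's, with the second bond `b` periodised and the family indexed by `b′`
  exact torus_symQ12_pureGauge_fst_fun_of_presentation hM hW pμ hpμ mμ b lam

/-- [folklore] **BI-WEIGHTED, GAUGE IN THE FIRST SLOT** (any box, any multiplier presentation):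
`Σ_b Σ_{b′} ((Dλ)_b · g b′) • Q₂^{b,b′} = −(R_λ * Q₁^{(g)} − Q₁^{(g)} * E_λ)`, `Q₁^{(g)} := Σ_{b′} g b′ • Q₁^{b′}` (B1's first-slot law at each second bond, summed). -/
theorem torus_symQ12_gauge_fst_of_presentation (hM : ∀ i, M i = Lc * M' i)
    (hW : W = fun κ' u' κ u x z a c => ∑' n : Site 4, symVh₂SAn1 3 Lc κ u κ' (translate M u' n) x z a c)
    (pμ : κI → Site 4) (hpμ : ∀ a, pμ a ∈ pbox M) (mμ : κI → Fin 4) (g : ↥(pbox M) × Fin 4 → ℝ) (lam : ↥(pbox M) → ℝ) :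
    (∑ b : ↥(pbox M) × Fin 4, ∑ b' : ↥(pbox M) × Fin 4, ((∑ s : ↥(pbox M), tgrad M (b.1, Sum.inl b.2) s * lam s) * g b') •
        (perF M (dper M (W b'.2 (b'.1 : Site 4) b.2 (b.1 : Site 4)))).submatrix
          (fun a : κI => ((⟨pμ a, hpμ a⟩, Sum.inr (mμ a)) : Idx M (Fib 3)))
          (fun c : ↥(pbox M) × Fin 4 => ((c.1, Sum.inl c.2) : Idx M (Fib 3))))
      = -(Matrix.diagonal (fun a : κI => ∑ s : ↥(pbox M), tdelta M (pμ a + ctr 4 Lc) s * lam s)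
            * (∑ b' : ↥(pbox M) × Fin 4, g b' • (perF M (dper M (symVhSAt (ctr 4 Lc) 3 Lc rfl b'.2 (b'.1 : Site 4)))).submatrix
              (fun a : κI => ((⟨pμ a, hpμ a⟩, Sum.inr (mμ a)) : Idx M (Fib 3)))
              (fun c : ↥(pbox M) × Fin 4 => ((c.1, Sum.inl c.2) : Idx M (Fib 3))))
          - (∑ b' : ↥(pbox M) × Fin 4, g b' • (perF M (dper M (symVhSAt (ctr 4 Lc) 3 Lc rfl b'.2 (b'.1 : Site 4)))).submatrix
              (fun a : κI => ((⟨pμ a, hpμ a⟩, Sum.inr (mμ a)) : Idx M (Fib 3)))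
              (fun c : ↥(pbox M) × Fin 4 => ((c.1, Sum.inl c.2) : Idx M (Fib 3))))
            * Matrix.diagonal (fun c : ↥(pbox M) × Fin 4 => lam c.1)) := by
  rw [Finset.sum_comm]
  have hinner : ∀ b' : ↥(pbox M) × Fin 4,
      (∑ b : ↥(pbox M) × Fin 4, ((∑ s : ↥(pbox M), tgrad M (b.1, Sum.inl b.2) s * lam s) * g b') •
          (perF M (dper M (W b'.2 (b'.1 : Site 4) b.2 (b.1 : Site 4)))).submatrix
            (fun a : κI => ((⟨pμ a, hpμ a⟩, Sum.inr (mμ a)) : Idx M (Fib 3)))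
            (fun c : ↥(pbox M) × Fin 4 => ((c.1, Sum.inl c.2) : Idx M (Fib 3))))
        = g b' • -(Matrix.diagonal (fun a : κI => ∑ s : ↥(pbox M), tdelta M (pμ a + ctr 4 Lc) s * lam s)
            * (perF M (dper M (symVhSAt (ctr 4 Lc) 3 Lc rfl b'.2 (b'.1 : Site 4)))).submatrix
              (fun a : κI => ((⟨pμ a, hpμ a⟩, Sum.inr (mμ a)) : Idx M (Fib 3)))
              (fun c : ↥(pbox M) × Fin 4 => ((c.1, Sum.inl c.2) : Idx M (Fib 3)))
          - (perF M (dper M (symVhSAt (ctr 4 Lc) 3 Lc rfl b'.2 (b'.1 : Site 4)))).submatrix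
              (fun a : κI => ((⟨pμ a, hpμ a⟩, Sum.inr (mμ a)) : Idx M (Fib 3)))
              (fun c : ↥(pbox M) × Fin 4 => ((c.1, Sum.inl c.2) : Idx M (Fib 3)))
            * Matrix.diagonal (fun c : ↥(pbox M) × Fin 4 => lam c.1)) := fun b' => by
    rw [← torus_symQ12_pureGauge_fst_fun_of_presentation hM hW pμ hpμ mμ b' lam, Finset.smul_sum]
    exact Finset.sum_congr rfl fun b _ => by rw [mul_comm, smul_smul]
  rw [Finset.sum_congr rfl fun b' _ => hinner b']
  simp only [smul_neg, smul_sub, Finset.sum_neg_distrib, Finset.sum_sub_distrib, Matrix.mul_sum, Matrix.sum_mul, Matrix.mul_smul,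
    Matrix.smul_mul]

/-- [folklore] **BI-WEIGHTED, GAUGE IN THE SECOND SLOT** (any box, any multiplier presentation):
`Σ_b Σ_{b′} (g b · (Dλ)_{b′}) • Q₂^{b,b′} = −(R_λ * Q₁^{(g)} − Q₁^{(g)} * E_λ)` (the second-slot law at each first bond `b`, summed). -/
theorem torus_symQ12_gauge_snd_of_presentation (hM : ∀ i, M i = Lc * M' i)
    (hW : W = fun κ' u' κ u x z a c => ∑' n : Site 4, symVh₂SAn1 3 Lc κ u κ' (translate M u' n) x z a c)
    (pμ : κI → Site 4) (hpμ : ∀ a, pμ a ∈ pbox M) (mμ : κI → Fin 4) (g : ↥(pbox M) × Fin 4 → ℝ) (lam : ↥(pbox M) → ℝ) :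
    (∑ b : ↥(pbox M) × Fin 4, ∑ b' : ↥(pbox M) × Fin 4, (g b * ∑ s : ↥(pbox M), tgrad M (b'.1, Sum.inl b'.2) s * lam s) •
        (perF M (dper M (W b'.2 (b'.1 : Site 4) b.2 (b.1 : Site 4)))).submatrix
          (fun a : κI => ((⟨pμ a, hpμ a⟩, Sum.inr (mμ a)) : Idx M (Fib 3)))
          (fun c : ↥(pbox M) × Fin 4 => ((c.1, Sum.inl c.2) : Idx M (Fib 3))))
      = -(Matrix.diagonal (fun a : κI => ∑ s : ↥(pbox M), tdelta M (pμ a + ctr 4 Lc) s * lam s)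
            * (∑ b : ↥(pbox M) × Fin 4, g b • (perF M (dper M (symVhSAt (ctr 4 Lc) 3 Lc rfl b.2 (b.1 : Site 4)))).submatrix
              (fun a : κI => ((⟨pμ a, hpμ a⟩, Sum.inr (mμ a)) : Idx M (Fib 3)))
              (fun c : ↥(pbox M) × Fin 4 => ((c.1, Sum.inl c.2) : Idx M (Fib 3))))
          - (∑ b : ↥(pbox M) × Fin 4, g b • (perF M (dper M (symVhSAt (ctr 4 Lc) 3 Lc rfl b.2 (b.1 : Site 4)))).submatrix
              (fun a : κI => ((⟨pμ a, hpμ a⟩, Sum.inr (mμ a)) : Idx M (Fib 3)))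
              (fun c : ↥(pbox M) × Fin 4 => ((c.1, Sum.inl c.2) : Idx M (Fib 3))))
            * Matrix.diagonal (fun c : ↥(pbox M) × Fin 4 => lam c.1)) := by
  have hinner : ∀ b : ↥(pbox M) × Fin 4,
      (∑ b' : ↥(pbox M) × Fin 4, (g b * ∑ s : ↥(pbox M), tgrad M (b'.1, Sum.inl b'.2) s * lam s) •
          (perF M (dper M (W b'.2 (b'.1 : Site 4) b.2 (b.1 : Site 4)))).submatrix
            (fun a : κI => ((⟨pμ a, hpμ a⟩, Sum.inr (mμ a)) : Idx M (Fib 3)))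
            (fun c : ↥(pbox M) × Fin 4 => ((c.1, Sum.inl c.2) : Idx M (Fib 3))))
        = g b • -(Matrix.diagonal (fun a : κI => ∑ s : ↥(pbox M), tdelta M (pμ a + ctr 4 Lc) s * lam s)
            * (perF M (dper M (symVhSAt (ctr 4 Lc) 3 Lc rfl b.2 (b.1 : Site 4)))).submatrix
              (fun a : κI => ((⟨pμ a, hpμ a⟩, Sum.inr (mμ a)) : Idx M (Fib 3)))
              (fun c : ↥(pbox M) × Fin 4 => ((c.1, Sum.inl c.2) : Idx M (Fib 3)))
          - (perF M (dper M (symVhSAt (ctr 4 Lc) 3 Lc rfl b.2 (b.1 : Site 4)))).submatrix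
              (fun a : κI => ((⟨pμ a, hpμ a⟩, Sum.inr (mμ a)) : Idx M (Fib 3)))
              (fun c : ↥(pbox M) × Fin 4 => ((c.1, Sum.inl c.2) : Idx M (Fib 3)))
            * Matrix.diagonal (fun c : ↥(pbox M) × Fin 4 => lam c.1)) := fun b => by
    rw [← torus_symQ12_pureGauge_snd_fun_of_presentation hM hW pμ hpμ mμ b lam, Finset.smul_sum]
    exact Finset.sum_congr rfl fun b' _ => by rw [smul_smul]
  rw [Finset.sum_congr rfl fun b _ => hinner b]
  simp only [smul_neg, smul_sub, Finset.sum_neg_distrib, Finset.sum_sub_distrib, Matrix.mul_sum, Matrix.sum_mul, Matrix.mul_smul,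
    Matrix.smul_mul]

end Presentation

/-! ## §3 The (III′) torus call's types -/

section TorusCall

variable (M'' : Fin 4 → ℕ) [∀ μ, NeZero (M'' μ)] {W : Fin 4 → Site 4 → Fin 4 → Site 4 → MKer 4 (Fib 3)}

/-- [folklore] **`torus_symQ12_pureGauge_snd_fun` — AT THE (III′) TORUS CALL's TYPES** (fine box `F = fine Lc M″`, rows `a ↦ (coarsePt M″ Lc a.1, inr a.2)` — the door's
`Q₁₁ ∕ Q₁₂` slot presentation): `Σ_{b′} (Dλ)_{b′} • Q₁₂^{b,b′} = −(R_λ * Q₁₁^{b} − Q₁₁^{b} * E_λ)`, `R_λ := diagonal (Σ_s tdelta F (Lc•a.1 + ρ_c) s · λ s)`. -/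
theorem torus_symQ12_pureGauge_snd_fun
    (hW : W = fun κ' u' κ u x z a c => ∑' n : Site 4, symVh₂SAn1 3 Lc κ u κ' (translate (fine Lc M'') u' n) x z a c)
    (b : ↥(pbox (fine Lc M'')) × Fin 4) (lam : ↥(pbox (fine Lc M'')) → ℝ) :
    (∑ b' : ↥(pbox (fine Lc M'')) × Fin 4, (∑ s : ↥(pbox (fine Lc M'')), tgrad (fine Lc M'') (b'.1, Sum.inl b'.2) s * lam s) •
        (perF (fine Lc M'') (dper (fine Lc M'') (W b'.2 (b'.1 : Site 4) b.2 (b.1 : Site 4)))).submatrix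
          (fun a : ↥(pbox M'') × Fin 4 => ((coarsePt M'' Lc a.1, Sum.inr a.2) : Idx (fine Lc M'') (Fib 3)))
          (fun c : ↥(pbox (fine Lc M'')) × Fin 4 => ((c.1, Sum.inl c.2) : Idx (fine Lc M'') (Fib 3))))
      = -(Matrix.diagonal (fun a : ↥(pbox M'') × Fin 4 =>
              ∑ s : ↥(pbox (fine Lc M'')), tdelta (fine Lc M'') ((Lc : ℤ) • (a.1 : Site 4) + ctr 4 Lc) s * lam s)
            * (perF (fine Lc M'') (dper (fine Lc M'') (symVhSAt (ctr 4 Lc) 3 Lc rfl b.2 (b.1 : Site 4)))).submatrix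
              (fun a : ↥(pbox M'') × Fin 4 => ((coarsePt M'' Lc a.1, Sum.inr a.2) : Idx (fine Lc M'') (Fib 3)))
              (fun c : ↥(pbox (fine Lc M'')) × Fin 4 => ((c.1, Sum.inl c.2) : Idx (fine Lc M'') (Fib 3)))
          - (perF (fine Lc M'') (dper (fine Lc M'') (symVhSAt (ctr 4 Lc) 3 Lc rfl b.2 (b.1 : Site 4)))).submatrix
              (fun a : ↥(pbox M'') × Fin 4 => ((coarsePt M'' Lc a.1, Sum.inr a.2) : Idx (fine Lc M'') (Fib 3)))
              (fun c : ↥(pbox (fine Lc M'')) × Fin 4 => ((c.1, Sum.inl c.2) : Idx (fine Lc M'') (Fib 3)))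
            * Matrix.diagonal (fun c : ↥(pbox (fine Lc M'')) × Fin 4 => lam c.1)) :=
  torus_symQ12_pureGauge_snd_fun_of_presentation (M := fine Lc M'') (M' := M'') (fun _ => rfl) hW
    (fun a : ↥(pbox M'') × Fin 4 => (coarsePt M'' Lc a.1 : Site 4)) (fun a => (coarsePt M'' Lc a.1).2) (fun a => a.2) b lam

/-- [folklore] **BI-WEIGHTED, GAUGE IN THE FIRST SLOT, AT THE (III′) TORUS CALL's TYPES**: `Σ_b Σ_{b′} ((Dλ)_b·g b′) • Q₁₂^{b,b′} = −(R_λ * Q₁₁^{(g)} − Q₁₁^{(g)} * E_λ)`. -/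
theorem torus_symQ12_gauge_fst
    (hW : W = fun κ' u' κ u x z a c => ∑' n : Site 4, symVh₂SAn1 3 Lc κ u κ' (translate (fine Lc M'') u' n) x z a c)
    (g : ↥(pbox (fine Lc M'')) × Fin 4 → ℝ) (lam : ↥(pbox (fine Lc M'')) → ℝ) :
    (∑ b : ↥(pbox (fine Lc M'')) × Fin 4, ∑ b' : ↥(pbox (fine Lc M'')) × Fin 4, ((∑ s : ↥(pbox (fine Lc M'')), tgrad (fine Lc M'') (b.1, Sum.inl b.2) s * lam s) * g b') •
        (perF (fine Lc M'') (dper (fine Lc M'') (W b'.2 (b'.1 : Site 4) b.2 (b.1 : Site 4)))).submatrix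
            (fun a : ↥(pbox M'') × Fin 4 => ((coarsePt M'' Lc a.1, Sum.inr a.2) : Idx (fine Lc M'') (Fib 3)))
            (fun c : ↥(pbox (fine Lc M'')) × Fin 4 => ((c.1, Sum.inl c.2) : Idx (fine Lc M'') (Fib 3))))
      = -(Matrix.diagonal (fun a : ↥(pbox M'') × Fin 4 =>
              ∑ s : ↥(pbox (fine Lc M'')), tdelta (fine Lc M'') ((Lc : ℤ) • (a.1 : Site 4) + ctr 4 Lc) s * lam s)
            * (∑ b' : ↥(pbox (fine Lc M'')) × Fin 4, g b' • (perF (fine Lc M'') (dper (fine Lc M'') (symVhSAt (ctr 4 Lc) 3 Lc rfl b'.2 (b'.1 : Site 4)))).submatrix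
                (fun a : ↥(pbox M'') × Fin 4 => ((coarsePt M'' Lc a.1, Sum.inr a.2) : Idx (fine Lc M'') (Fib 3)))
                (fun c : ↥(pbox (fine Lc M'')) × Fin 4 => ((c.1, Sum.inl c.2) : Idx (fine Lc M'') (Fib 3))))
          - (∑ b' : ↥(pbox (fine Lc M'')) × Fin 4, g b' • (perF (fine Lc M'') (dper (fine Lc M'') (symVhSAt (ctr 4 Lc) 3 Lc rfl b'.2 (b'.1 : Site 4)))).submatrix
                (fun a : ↥(pbox M'') × Fin 4 => ((coarsePt M'' Lc a.1, Sum.inr a.2) : Idx (fine Lc M'') (Fib 3)))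
                (fun c : ↥(pbox (fine Lc M'')) × Fin 4 => ((c.1, Sum.inl c.2) : Idx (fine Lc M'') (Fib 3))))
            * Matrix.diagonal (fun c : ↥(pbox (fine Lc M'')) × Fin 4 => lam c.1)) :=
  torus_symQ12_gauge_fst_of_presentation (M := fine Lc M'') (M' := M'') (fun _ => rfl) hW
    (fun a : ↥(pbox M'') × Fin 4 => (coarsePt M'' Lc a.1 : Site 4)) (fun a => (coarsePt M'' Lc a.1).2) (fun a => a.2) g lam

/-- [folklore] **BI-WEIGHTED, GAUGE IN THE SECOND SLOT, AT THE (III′) TORUS CALL's TYPES**: `Σ_b Σ_{b′} (g b·(Dλ)_{b′}) • Q₁₂^{b,b′} = −(R_λ * Q₁₁^{(g)} − Q₁₁^{(g)} * E_λ)`. -/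
theorem torus_symQ12_gauge_snd
    (hW : W = fun κ' u' κ u x z a c => ∑' n : Site 4, symVh₂SAn1 3 Lc κ u κ' (translate (fine Lc M'') u' n) x z a c)
    (g : ↥(pbox (fine Lc M'')) × Fin 4 → ℝ) (lam : ↥(pbox (fine Lc M'')) → ℝ) :
    (∑ b : ↥(pbox (fine Lc M'')) × Fin 4, ∑ b' : ↥(pbox (fine Lc M'')) × Fin 4, (g b * ∑ s : ↥(pbox (fine Lc M'')), tgrad (fine Lc M'') (b'.1, Sum.inl b'.2) s * lam s) •
        (perF (fine Lc M'') (dper (fine Lc M'') (W b'.2 (b'.1 : Site 4) b.2 (b.1 : Site 4)))).submatrix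
            (fun a : ↥(pbox M'') × Fin 4 => ((coarsePt M'' Lc a.1, Sum.inr a.2) : Idx (fine Lc M'') (Fib 3)))
            (fun c : ↥(pbox (fine Lc M'')) × Fin 4 => ((c.1, Sum.inl c.2) : Idx (fine Lc M'') (Fib 3))))
      = -(Matrix.diagonal (fun a : ↥(pbox M'') × Fin 4 =>
              ∑ s : ↥(pbox (fine Lc M'')), tdelta (fine Lc M'') ((Lc : ℤ) • (a.1 : Site 4) + ctr 4 Lc) s * lam s)
            * (∑ b : ↥(pbox (fine Lc M'')) × Fin 4, g b • (perF (fine Lc M'') (dper (fine Lc M'') (symVhSAt (ctr 4 Lc) 3 Lc rfl b.2 (b.1 : Site 4)))).submatrix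
                (fun a : ↥(pbox M'') × Fin 4 => ((coarsePt M'' Lc a.1, Sum.inr a.2) : Idx (fine Lc M'') (Fib 3)))
                (fun c : ↥(pbox (fine Lc M'')) × Fin 4 => ((c.1, Sum.inl c.2) : Idx (fine Lc M'') (Fib 3))))
          - (∑ b : ↥(pbox (fine Lc M'')) × Fin 4, g b • (perF (fine Lc M'') (dper (fine Lc M'') (symVhSAt (ctr 4 Lc) 3 Lc rfl b.2 (b.1 : Site 4)))).submatrix
                (fun a : ↥(pbox M'') × Fin 4 => ((coarsePt M'' Lc a.1, Sum.inr a.2) : Idx (fine Lc M'') (Fib 3)))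
                (fun c : ↥(pbox (fine Lc M'')) × Fin 4 => ((c.1, Sum.inl c.2) : Idx (fine Lc M'') (Fib 3))))
            * Matrix.diagonal (fun c : ↥(pbox (fine Lc M'')) × Fin 4 => lam c.1)) :=
  torus_symQ12_gauge_snd_of_presentation (M := fine Lc M'') (M' := M'') (fun _ => rfl) hW
    (fun a : ↥(pbox M'') × Fin 4 => (coarsePt M'' Lc a.1 : Site 4)) (fun a => (coarsePt M'' Lc a.1).2) (fun a => a.2) g lam

end TorusCall

end Summit.QuantumFields.BalabanUV.Beta.FP.PeriodisedSymBorderT2IndexWardSnd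

end
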